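import Mathlib
import HarnessLib
import Summits.AtomisticToContinuum.Crystallization.Theorems.FrustratedLawDichotomyAperiodicFrustratedLawGapErgodicOperatorFix

/-!
# Ergodic reduction for the crux `AperiodicFrustratedLawGap` — the re-rooting kernel and the pointwise averages

Route `FrustratedLawDichotomy`, crux `AperiodicFrustratedLawGap` (item `stmt-AtomisticToContinuum-27623`),
registered stub `stub_ergodicReduction` (skeleton `dd3251ad731e`); tenth brick of step D5 (`hErg`; evidence
`D5-PLAN.md`, S1): identification of the Hilbert-space operator `P = E† U E` (`…ErgodicOperator[Fix]`) with
POINTWISE averages.  The RE-ROOTING KERNEL `K = κ₀.withDensity W` (`K(S, ·)` = the probability measure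
`Σ_{y∈S} W(S,y) δ_y` on the points of `S`) gives the pointwise lazy average of a real function,
`(P f)(S) = ∫ f((Θ(S,y)).1) dK(S)(y) = Σ_{y∈S} w(y) f(S−y) + (1 − Σ w) f(S)`, defined at EVERY configuration and
for EVERY law — the measure-independent object needed in steps S2–S5.

* `measurable_uncurry_campbellWeight`, `isMarkovKernel_rerootKernel` — `K` is a Markov kernel;
* `compProd_rerootKernel` — `ν ⊗ₘ K = (ν ⊗ₘ κ₀).withDensity W = π`;
* `integral_mul_rerootAverage` — `∫ g · (S ↦ ∫ f((Θ(S,y)).1) dK(S)(y)) dν = ∫ g(q.1) f((Θ q).1) dπ(q)` for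
  `g ∈ L¹(ν)` and bounded measurable `f`;
* `exists_rerootOperator_pt` — the operator of `…ErgodicOperatorFix` with its matrix elements expressed through
  the pointwise averages: `⟪g, P f⟫ = ∫ g · (pointwise average of f) dν`.

`[folklore]`.
-/

noncomputable section

namespace Summit.AtomisticToContinuum.Crystallization.Theorems.FrustratedLawDichotomyErgodicReduction

open MeasureTheory Set Filter ProbabilityTheory
open scoped ENNReal Classical InnerProductSpace
open Literature.Probability.Process (LocalConfig)
open Literature.Probability.Process.LocalConfig (RootedHardCoreConfig toMeasure_def measurable_toMeasure)
open Summit.AtomisticToContinuum.Crystallization.Theorems.BenjaminiSchrammLimit (isSFiniteKernel_toMeasure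
  measurable_reroot)

variable {δ : ℝ}

/-- The (curried) Campbell weight is jointly measurable (`δ > 0`). [folklore] -/
theorem measurable_uncurry_campbellWeight [Fact (0 < δ)] {w : EuclideanSpace ℝ (Fin 3) → ℝ≥0∞} (hw : Measurable w) :
    Measurable (Function.uncurry
      (fun (S : RootedHardCoreConfig (EuclideanSpace ℝ (Fin 3)) δ) (y : EuclideanSpace ℝ (Fin 3)) =>
        w y + (1 - ∫⁻ z, w z ∂((S.1 : LocalConfig (EuclideanSpace ℝ (Fin 3))).toMeasure)) *
          ({(0 : EuclideanSpace ℝ (Fin 3))} : Set (EuclideanSpace ℝ (Fin 3))).indicator (fun _ => (1 : ℝ≥0∞)) y)) :=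
  (hw.comp measurable_snd).add ((measurable_const.sub ((measurable_lintegral_weight hw).comp measurable_fst)).mul
    ((measurable_const.indicator (measurableSet_singleton 0)).comp measurable_snd))

/-- **The re-rooting kernel is Markov**: `K(S) = Σ_{y∈S} W(S,y) δ_y` is a probability measure for every
configuration (`δ > 0`, weight of mass `≤ 1`). [folklore] -/
theorem isMarkovKernel_rerootKernel [Fact (0 < δ)] {w : EuclideanSpace ℝ (Fin 3) → ℝ≥0∞} (hw : Measurable w)
    (hw1 : ∀ S : RootedHardCoreConfig (EuclideanSpace ℝ (Fin 3)) δ,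
      ∫⁻ y, w y ∂((S.1 : LocalConfig (EuclideanSpace ℝ (Fin 3))).toMeasure) ≤ 1) :
    haveI := isSFiniteKernel_toMeasure (E := EuclideanSpace ℝ (Fin 3)) (δ := δ)
    IsMarkovKernel (Kernel.withDensity (⟨fun S : RootedHardCoreConfig (EuclideanSpace ℝ (Fin 3)) δ =>
        (S.1 : LocalConfig (EuclideanSpace ℝ (Fin 3))).toMeasure,
        measurable_toMeasure (Fact.out : 0 < δ)⟩ :
        Kernel (RootedHardCoreConfig (EuclideanSpace ℝ (Fin 3)) δ) (EuclideanSpace ℝ (Fin 3)))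
      (fun (S : RootedHardCoreConfig (EuclideanSpace ℝ (Fin 3)) δ) (y : EuclideanSpace ℝ (Fin 3)) =>
        w y + (1 - ∫⁻ z, w z ∂((S.1 : LocalConfig (EuclideanSpace ℝ (Fin 3))).toMeasure)) *
          ({(0 : EuclideanSpace ℝ (Fin 3))} : Set (EuclideanSpace ℝ (Fin 3))).indicator (fun _ => (1 : ℝ≥0∞)) y)) := by
  haveI := isSFiniteKernel_toMeasure (E := EuclideanSpace ℝ (Fin 3)) (δ := δ)
  refine ⟨fun S => ⟨?_⟩⟩
  rw [Kernel.withDensity_apply' _ (measurable_uncurry_campbellWeight hw), Measure.restrict_univ]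
  exact lintegral_campbellWeight_eq_one hw S (hw1 S)

/-- **The law composed with the re-rooting kernel is the weighted Campbell measure**:
`ν ⊗ₘ K = (ν ⊗ₘ κ₀).withDensity W`. [folklore] -/
theorem compProd_rerootKernel [Fact (0 < δ)] (ν : Measure (RootedHardCoreConfig (EuclideanSpace ℝ (Fin 3)) δ)) [SFinite ν]
    {w : EuclideanSpace ℝ (Fin 3) → ℝ≥0∞} (hw : Measurable w)
    (hw1 : ∀ S : RootedHardCoreConfig (EuclideanSpace ℝ (Fin 3)) δ,
      ∫⁻ y, w y ∂((S.1 : LocalConfig (EuclideanSpace ℝ (Fin 3))).toMeasure) ≤ 1) :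
    haveI := isSFiniteKernel_toMeasure (E := EuclideanSpace ℝ (Fin 3)) (δ := δ)
    ν ⊗ₘ (Kernel.withDensity (⟨fun S : RootedHardCoreConfig (EuclideanSpace ℝ (Fin 3)) δ =>
        (S.1 : LocalConfig (EuclideanSpace ℝ (Fin 3))).toMeasure,
        measurable_toMeasure (Fact.out : 0 < δ)⟩ :
        Kernel (RootedHardCoreConfig (EuclideanSpace ℝ (Fin 3)) δ) (EuclideanSpace ℝ (Fin 3)))
      (fun (S : RootedHardCoreConfig (EuclideanSpace ℝ (Fin 3)) δ) (y : EuclideanSpace ℝ (Fin 3)) =>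
        w y + (1 - ∫⁻ z, w z ∂((S.1 : LocalConfig (EuclideanSpace ℝ (Fin 3))).toMeasure)) *
          ({(0 : EuclideanSpace ℝ (Fin 3))} : Set (EuclideanSpace ℝ (Fin 3))).indicator (fun _ => (1 : ℝ≥0∞)) y)) =
    (ν ⊗ₘ (⟨fun S : RootedHardCoreConfig (EuclideanSpace ℝ (Fin 3)) δ =>
        (S.1 : LocalConfig (EuclideanSpace ℝ (Fin 3))).toMeasure,
        measurable_toMeasure (Fact.out : 0 < δ)⟩ :
        Kernel (RootedHardCoreConfig (EuclideanSpace ℝ (Fin 3)) δ) (EuclideanSpace ℝ (Fin 3)))).withDensity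
      (fun p : RootedHardCoreConfig (EuclideanSpace ℝ (Fin 3)) δ × EuclideanSpace ℝ (Fin 3) =>
        w p.2 + (1 - ∫⁻ z, w z ∂((p.1.1 : LocalConfig (EuclideanSpace ℝ (Fin 3))).toMeasure)) *
          ({(0 : EuclideanSpace ℝ (Fin 3))} : Set (EuclideanSpace ℝ (Fin 3))).indicator (fun _ => (1 : ℝ≥0∞)) p.2) := by
  haveI := isSFiniteKernel_toMeasure (E := EuclideanSpace ℝ (Fin 3)) (δ := δ)
  haveI := isMarkovKernel_rerootKernel (δ := δ) hw hw1
  exact Measure.compProd_withDensity (measurable_uncurry_campbellWeight hw)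

/-- **Matrix elements through the pointwise averages.**  For a finite law `ν` (`δ > 0`, weight of mass
`≤ 1`), `g ∈ L¹(ν)` and a bounded measurable `f`:
`∫ g(S) · (∫ f((Θ(S,y)).1) dK(S)(y)) dν(S) = ∫ g(q.1) f((Θ q).1) dπ(q)`. [folklore] -/
theorem integral_mul_rerootAverage [Fact (0 < δ)] (ν : Measure (RootedHardCoreConfig (EuclideanSpace ℝ (Fin 3)) δ)) [IsFiniteMeasure ν]
    {w : EuclideanSpace ℝ (Fin 3) → ℝ≥0∞} (hw : Measurable w)
    (hw1 : ∀ S : RootedHardCoreConfig (EuclideanSpace ℝ (Fin 3)) δ,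
      ∫⁻ y, w y ∂((S.1 : LocalConfig (EuclideanSpace ℝ (Fin 3))).toMeasure) ≤ 1)
    {f g : RootedHardCoreConfig (EuclideanSpace ℝ (Fin 3)) δ → ℝ} (hf : Measurable f) (hfb : ∃ C : ℝ, ∀ S, ‖f S‖ ≤ C) (hg : Integrable g ν) :
    ∫ S, g S * (∫ y, f ((fun p : RootedHardCoreConfig (EuclideanSpace ℝ (Fin 3)) δ × EuclideanSpace ℝ (Fin 3) =>
        ((if h : p.2 ∈ ((p.1.1 : LocalConfig (EuclideanSpace ℝ (Fin 3))) : Set (EuclideanSpace ℝ (Fin 3)))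
          then p.1.reroot p.2 h else p.1 : RootedHardCoreConfig (EuclideanSpace ℝ (Fin 3)) δ), -p.2)) (S, y)).1
        ∂(haveI := isSFiniteKernel_toMeasure (E := EuclideanSpace ℝ (Fin 3)) (δ := δ)
          Kernel.withDensity (⟨fun S : RootedHardCoreConfig (EuclideanSpace ℝ (Fin 3)) δ =>
        (S.1 : LocalConfig (EuclideanSpace ℝ (Fin 3))).toMeasure,
        measurable_toMeasure (Fact.out : 0 < δ)⟩ :
        Kernel (RootedHardCoreConfig (EuclideanSpace ℝ (Fin 3)) δ) (EuclideanSpace ℝ (Fin 3)))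
          (fun (S : RootedHardCoreConfig (EuclideanSpace ℝ (Fin 3)) δ) (y : EuclideanSpace ℝ (Fin 3)) =>
        w y + (1 - ∫⁻ z, w z ∂((S.1 : LocalConfig (EuclideanSpace ℝ (Fin 3))).toMeasure)) *
          ({(0 : EuclideanSpace ℝ (Fin 3))} : Set (EuclideanSpace ℝ (Fin 3))).indicator (fun _ => (1 : ℝ≥0∞)) y) S)) ∂ν =
    ∫ q, g q.1 * f ((fun p : RootedHardCoreConfig (EuclideanSpace ℝ (Fin 3)) δ × EuclideanSpace ℝ (Fin 3) =>
        ((if h : p.2 ∈ ((p.1.1 : LocalConfig (EuclideanSpace ℝ (Fin 3))) : Set (EuclideanSpace ℝ (Fin 3)))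
          then p.1.reroot p.2 h else p.1 : RootedHardCoreConfig (EuclideanSpace ℝ (Fin 3)) δ), -p.2)) q).1 ∂(haveI := isSFiniteKernel_toMeasure (E := EuclideanSpace ℝ (Fin 3)) (δ := δ)
      ((ν ⊗ₘ (⟨fun S : RootedHardCoreConfig (EuclideanSpace ℝ (Fin 3)) δ =>
        (S.1 : LocalConfig (EuclideanSpace ℝ (Fin 3))).toMeasure,
        measurable_toMeasure (Fact.out : 0 < δ)⟩ :
        Kernel (RootedHardCoreConfig (EuclideanSpace ℝ (Fin 3)) δ) (EuclideanSpace ℝ (Fin 3)))).withDensity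
      (fun p : RootedHardCoreConfig (EuclideanSpace ℝ (Fin 3)) δ × EuclideanSpace ℝ (Fin 3) =>
        w p.2 + (1 - ∫⁻ z, w z ∂((p.1.1 : LocalConfig (EuclideanSpace ℝ (Fin 3))).toMeasure)) *
          ({(0 : EuclideanSpace ℝ (Fin 3))} : Set (EuclideanSpace ℝ (Fin 3))).indicator (fun _ => (1 : ℝ≥0∞)) p.2))) := by
  haveI := isSFiniteKernel_toMeasure (E := EuclideanSpace ℝ (Fin 3)) (δ := δ)
  haveI := isMarkovKernel_rerootKernel (δ := δ) hw hw1
  have hδ : 0 < δ := Fact.out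
  have hΘ : Measurable (fun p : RootedHardCoreConfig (EuclideanSpace ℝ (Fin 3)) δ × EuclideanSpace ℝ (Fin 3) =>
        ((if h : p.2 ∈ ((p.1.1 : LocalConfig (EuclideanSpace ℝ (Fin 3))) : Set (EuclideanSpace ℝ (Fin 3)))
          then p.1.reroot p.2 h else p.1 : RootedHardCoreConfig (EuclideanSpace ℝ (Fin 3)) δ), -p.2)) := measurable_reroot hδ
  have hfst := measurePreserving_fst_campbell (δ := δ) ν hw hw1
  obtain ⟨C, hC⟩ := hfb
  rw [← compProd_rerootKernel ν hw hw1] at hfst ⊢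
  have hint : Integrable (fun q : RootedHardCoreConfig (EuclideanSpace ℝ (Fin 3)) δ × EuclideanSpace ℝ (Fin 3) => g q.1 * f ((fun p : RootedHardCoreConfig (EuclideanSpace ℝ (Fin 3)) δ × EuclideanSpace ℝ (Fin 3) =>
        ((if h : p.2 ∈ ((p.1.1 : LocalConfig (EuclideanSpace ℝ (Fin 3))) : Set (EuclideanSpace ℝ (Fin 3)))
          then p.1.reroot p.2 h else p.1 : RootedHardCoreConfig (EuclideanSpace ℝ (Fin 3)) δ), -p.2)) q).1)
      (ν ⊗ₘ (Kernel.withDensity (⟨fun S : RootedHardCoreConfig (EuclideanSpace ℝ (Fin 3)) δ =>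
        (S.1 : LocalConfig (EuclideanSpace ℝ (Fin 3))).toMeasure,
        measurable_toMeasure (Fact.out : 0 < δ)⟩ :
        Kernel (RootedHardCoreConfig (EuclideanSpace ℝ (Fin 3)) δ) (EuclideanSpace ℝ (Fin 3)))
        (fun (S : RootedHardCoreConfig (EuclideanSpace ℝ (Fin 3)) δ) (y : EuclideanSpace ℝ (Fin 3)) =>
        w y + (1 - ∫⁻ z, w z ∂((S.1 : LocalConfig (EuclideanSpace ℝ (Fin 3))).toMeasure)) *
          ({(0 : EuclideanSpace ℝ (Fin 3))} : Set (EuclideanSpace ℝ (Fin 3))).indicator (fun _ => (1 : ℝ≥0∞)) y))) := by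
    refine Integrable.mul_bdd (hfst.integrable_comp_of_integrable hg) (hf.comp hΘ.fst).aestronglyMeasurable
      (Eventually.of_forall fun q => hC _)
  rw [Measure.integral_compProd hint]
  refine integral_congr_ae (Eventually.of_forall fun S => ?_)
  exact (integral_const_mul (g S) _).symm

/-- **The re-rooting operator with pointwise matrix elements** (`δ > 0`).  For a probability law `ν` on rooted
`δ`-hard-core configurations with Campbell measure invariant under re-rooting and a measurable even weight `w`
of mass `≤ 1`: there is a contraction `P` of `L²(ν)` whose fixed points are invariant along `π`-almost every
edge and whose matrix elements against bounded measurable `f` are those of the POINTWISE average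
`S ↦ ∫ f((Θ(S,y)).1) dK(S)(y)`: `⟪g, P f⟫ = ∫ g · (pointwise average of f) dν`.  (So `P [f] = [pointwise average
of f]`, and the Cesàro averages of `P` are the classes of the pointwise Cesàro averages.) [folklore] -/
theorem exists_rerootOperator_pt [Fact (0 < δ)]
    {ν : Measure (RootedHardCoreConfig (EuclideanSpace ℝ (Fin 3)) δ)} [IsProbabilityMeasure ν]
    (hinv : haveI := isSFiniteKernel_toMeasure (E := EuclideanSpace ℝ (Fin 3)) (δ := δ)
      (ν ⊗ₘ (⟨fun S : RootedHardCoreConfig (EuclideanSpace ℝ (Fin 3)) δ =>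
        (S.1 : LocalConfig (EuclideanSpace ℝ (Fin 3))).toMeasure,
        measurable_toMeasure (Fact.out : 0 < δ)⟩ :
        Kernel (RootedHardCoreConfig (EuclideanSpace ℝ (Fin 3)) δ) (EuclideanSpace ℝ (Fin 3)))).map
      (fun p : RootedHardCoreConfig (EuclideanSpace ℝ (Fin 3)) δ × EuclideanSpace ℝ (Fin 3) =>
        ((if h : p.2 ∈ ((p.1.1 : LocalConfig (EuclideanSpace ℝ (Fin 3))) : Set (EuclideanSpace ℝ (Fin 3)))
          then p.1.reroot p.2 h else p.1 : RootedHardCoreConfig (EuclideanSpace ℝ (Fin 3)) δ), -p.2)) =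
      ν ⊗ₘ (⟨fun S : RootedHardCoreConfig (EuclideanSpace ℝ (Fin 3)) δ =>
        (S.1 : LocalConfig (EuclideanSpace ℝ (Fin 3))).toMeasure,
        measurable_toMeasure (Fact.out : 0 < δ)⟩ :
        Kernel (RootedHardCoreConfig (EuclideanSpace ℝ (Fin 3)) δ) (EuclideanSpace ℝ (Fin 3))))
    {w : EuclideanSpace ℝ (Fin 3) → ℝ≥0∞} (hw : Measurable w) (hws : ∀ y, w (-y) = w y)
    (hw1 : ∀ S : RootedHardCoreConfig (EuclideanSpace ℝ (Fin 3)) δ,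
      ∫⁻ y, w y ∂((S.1 : LocalConfig (EuclideanSpace ℝ (Fin 3))).toMeasure) ≤ 1) :
    ∃ P : Lp ℝ 2 ν →L[ℝ] Lp ℝ 2 ν, ‖P‖ ≤ 1 ∧
      (∀ (h : RootedHardCoreConfig (EuclideanSpace ℝ (Fin 3)) δ → ℝ) (hh : MemLp h 2 ν), P (hh.toLp h) = hh.toLp h →
        ∀ᵐ q ∂(haveI := isSFiniteKernel_toMeasure (E := EuclideanSpace ℝ (Fin 3)) (δ := δ)
      ((ν ⊗ₘ (⟨fun S : RootedHardCoreConfig (EuclideanSpace ℝ (Fin 3)) δ =>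
        (S.1 : LocalConfig (EuclideanSpace ℝ (Fin 3))).toMeasure,
        measurable_toMeasure (Fact.out : 0 < δ)⟩ :
        Kernel (RootedHardCoreConfig (EuclideanSpace ℝ (Fin 3)) δ) (EuclideanSpace ℝ (Fin 3)))).withDensity
      (fun p : RootedHardCoreConfig (EuclideanSpace ℝ (Fin 3)) δ × EuclideanSpace ℝ (Fin 3) =>
        w p.2 + (1 - ∫⁻ z, w z ∂((p.1.1 : LocalConfig (EuclideanSpace ℝ (Fin 3))).toMeasure)) *
          ({(0 : EuclideanSpace ℝ (Fin 3))} : Set (EuclideanSpace ℝ (Fin 3))).indicator (fun _ => (1 : ℝ≥0∞)) p.2))),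
          h ((fun p : RootedHardCoreConfig (EuclideanSpace ℝ (Fin 3)) δ × EuclideanSpace ℝ (Fin 3) =>
        ((if h : p.2 ∈ ((p.1.1 : LocalConfig (EuclideanSpace ℝ (Fin 3))) : Set (EuclideanSpace ℝ (Fin 3)))
          then p.1.reroot p.2 h else p.1 : RootedHardCoreConfig (EuclideanSpace ℝ (Fin 3)) δ), -p.2)) q).1 = h q.1) ∧
      ∀ (f g : RootedHardCoreConfig (EuclideanSpace ℝ (Fin 3)) δ → ℝ) (hf2 : MemLp f 2 ν) (hg2 : MemLp g 2 ν), Measurable f → (∃ C : ℝ, ∀ S, ‖f S‖ ≤ C) →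
        ⟪hg2.toLp g, P (hf2.toLp f)⟫_ℝ =
          ∫ S, g S * (∫ y, f ((fun p : RootedHardCoreConfig (EuclideanSpace ℝ (Fin 3)) δ × EuclideanSpace ℝ (Fin 3) =>
        ((if h : p.2 ∈ ((p.1.1 : LocalConfig (EuclideanSpace ℝ (Fin 3))) : Set (EuclideanSpace ℝ (Fin 3)))
          then p.1.reroot p.2 h else p.1 : RootedHardCoreConfig (EuclideanSpace ℝ (Fin 3)) δ), -p.2)) (S, y)).1
            ∂(haveI := isSFiniteKernel_toMeasure (E := EuclideanSpace ℝ (Fin 3)) (δ := δ)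
              Kernel.withDensity (⟨fun S : RootedHardCoreConfig (EuclideanSpace ℝ (Fin 3)) δ =>
        (S.1 : LocalConfig (EuclideanSpace ℝ (Fin 3))).toMeasure,
        measurable_toMeasure (Fact.out : 0 < δ)⟩ :
        Kernel (RootedHardCoreConfig (EuclideanSpace ℝ (Fin 3)) δ) (EuclideanSpace ℝ (Fin 3)))
              (fun (S : RootedHardCoreConfig (EuclideanSpace ℝ (Fin 3)) δ) (y : EuclideanSpace ℝ (Fin 3)) =>
        w y + (1 - ∫⁻ z, w z ∂((S.1 : LocalConfig (EuclideanSpace ℝ (Fin 3))).toMeasure)) *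
          ({(0 : EuclideanSpace ℝ (Fin 3))} : Set (EuclideanSpace ℝ (Fin 3))).indicator (fun _ => (1 : ℝ≥0∞)) y) S)) ∂ν := by
  obtain ⟨P, hP1, hme, hfix⟩ := exists_rerootOperator_fix (δ := δ) hinv hw hws hw1
  refine ⟨P, hP1, hfix, fun f g hf2 hg2 hfm hfb => ?_⟩
  rw [hme f g hf2 hg2, ← integral_mul_rerootAverage ν hw hw1 hfm hfb (hg2.integrable one_le_two)]

end Summit.AtomisticToContinuum.Crystallization.Theorems.FrustratedLawDichotomyErgodicReduction

end
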